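import Summits.CriticalPhenomena.PercolationContinuityZ3.Theorems.PercNearOneGluingNoHeavyConstsIntervalLawEmptyRow
import Literature.Probability.Percolation.BergKahnAvoidance
import HarnessLib

/-!
# The LATTICE form of the interval law: reduction of its `[Q, P∪Q]` part to the nested law (PAPER-2 track (ii); seat `prim-consts-2`, gen 13)

builds on p205010 (kernel theorem, internal audit signed; external expert review pending).  Support file (`--supports
stmt-CriticalPhenomena-4575`); memo `run/shared/lean/prim/consts/FROM-prim-consts-2-g13-ADMISSIBILITY.md` §1.  No definitions, no named facts, no sorries.

For a source `s`, markers `y, z`, ANY two avoided vertex sets `P, Q` (not necessarily nested; `I = P∩Q`, `U = P∪Q`, `K_A = μ{s ↮ A}`) the van den Berg–Kahn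
gap `g_t(P,Q) := K_I·K_{U∪{t}} − K_P·K_{Q∪{t}}` is `≥ 0` (log-supermodularity of the avoidance kernel; for `Q ⊆ P` it is the nested gap `F_{Q,P}(t)` of
`Consts.AvoidanceIntervalLaw`).  The LATTICE INTERVAL LAW (conjecture, memo §1; 0 violations / 1.9·10⁵ exact triples with `C ∈ [I, U]`, violated iff `I ⊄ C`)
says `p′(C)·g_y(P,Q) ≤ g_z(P,Q)` for every `C ∈ [P∧Q, P∨Q]`, `p′(C) = P(y↔z | y ↮ {s}∪C, s ↮ C)`.  This file records the kernel part of its structure: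

* `Consts.latticeGap_identity` — `K_U·g_t(P,Q) = K_P·F_{Q,U}(t) + (K_IK_U − K_PK_Q)·K_{U∪t}` (ring identity);
* `Consts.latticeLaw_of_nested` — for `Q ⊆ C ⊆ P∪Q`: the lattice inequality at `(P,Q;C)` FOLLOWS from the nested one at `(Q, P∪Q; C)` (an instance of
  `Consts.AvoidanceIntervalLaw`), by the identity, van den Berg–Kahn's `K_PK_Q ≤ K_IK_U` (`BergKahnAvoidanceLSM_holds`) and the PROVED zeroth-order inequality
  `Consts.threeSep_notReach_le_of_subset` (`μ(T_C∩W)·K_{U∪y} ≤ μ(T_C)·K_{U∪z}` for `C ⊆ U`).  So on `[Q, P∪Q]` the lattice law is not new content; its part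
  `C ⊉ Q∖P` (down to `C = P∩Q`) is the nested law at set-valued markers and stays a separate conjecture.
[cite: VandenbergKahn2001, Thm 1.2 (p. 123)] [cite: VandenbergHaggstromKahn2005, Thm. 1.3 (p. 6), Thm. 2.1 (p. 9)]
-/

noncomputable section

namespace Summit.CriticalPhenomena.PercolationContinuityZ3.Theorems

open MeasureTheory Set Literature.Probability.LatticeModels Literature.Probability.Percolation
open scoped Classical

namespace Consts

/-- **The lattice-gap identity**: `K_U·(K_IK_{Ut} − K_PK_{Qt}) = K_P·(K_QK_{Ut} − K_UK_{Qt}) + (K_IK_U − K_PK_Q)·K_{Ut}` (a ring identity in the six numbers).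
[folklore] -/
theorem latticeGap_identity (kI kP kQ kU kQt kUt : ℝ) :
    kU * (kI * kUt - kP * kQt) = kP * (kQ * kUt - kU * kQt) + (kI * kU - kP * kQ) * kUt := by
  ring

variable {V : Type} [Fintype V]

/-- **The lattice interval law on `[Q, P∪Q]` follows from the nested law.**  For vertex sets `P, Q, C` with `C ⊆ P ∪ Q`, if the nested
interval-law inequality holds at `(A, B; C) = (Q, P∪Q; C)` (for `Q ⊆ C` an instance of `Consts.AvoidanceIntervalLaw`), i.e. `μ(T_C∩W)·F_{Q,P∪Q}(y) ≤ μ(T_C)·F_{Q,P∪Q}(z)`, then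
`μ(T_C∩W)·g_y(P,Q) ≤ μ(T_C)·g_z(P,Q)` with `g_t(P,Q) = K_{P∩Q}K_{P∪Q∪{t}} − K_PK_{Q∪{t}}`, `T_C = {y ↮ {s}∪C} ∩ {s ↮ C}`.
Ingredients: `Consts.latticeGap_identity`, `K_PK_Q ≤ K_{P∩Q}K_{P∪Q}` (van den Berg–Kahn) and `Consts.threeSep_notReach_le_of_subset` (`C ⊆ P∪Q`).
[cite: VandenbergKahn2001, Thm 1.2 (p. 123)] [cite: VandenbergHaggstromKahn2005, Thm. 1.3 (p. 6), Thm. 2.1 (p. 9) — corollary, derived here] -/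
theorem latticeLaw_of_nested (w : Sym2 V → unitInterval) (s y z : V) {P Q C : Set V} (hCU : C ⊆ P ∪ Q)
    (h : (prodBernoulli w).real ({ω : BondConfig V | ∀ x ∈ insert s C, ¬ (openGraph ω).Reachable y x} ∩
          {ω | ∀ x ∈ C, ¬ (openGraph ω).Reachable s x} ∩ openConn y z) *
        ((prodBernoulli w).real {ω : BondConfig V | ∀ x ∈ Q, ¬ (openGraph ω).Reachable s x} *
            (prodBernoulli w).real {ω : BondConfig V | ∀ x ∈ insert y (P ∪ Q), ¬ (openGraph ω).Reachable s x} -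
          (prodBernoulli w).real {ω : BondConfig V | ∀ x ∈ P ∪ Q, ¬ (openGraph ω).Reachable s x} *
            (prodBernoulli w).real {ω : BondConfig V | ∀ x ∈ insert y Q, ¬ (openGraph ω).Reachable s x}) ≤
      (prodBernoulli w).real ({ω : BondConfig V | ∀ x ∈ insert s C, ¬ (openGraph ω).Reachable y x} ∩
          {ω | ∀ x ∈ C, ¬ (openGraph ω).Reachable s x}) *
        ((prodBernoulli w).real {ω : BondConfig V | ∀ x ∈ Q, ¬ (openGraph ω).Reachable s x} *
            (prodBernoulli w).real {ω : BondConfig V | ∀ x ∈ insert z (P ∪ Q), ¬ (openGraph ω).Reachable s x} -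
          (prodBernoulli w).real {ω : BondConfig V | ∀ x ∈ P ∪ Q, ¬ (openGraph ω).Reachable s x} *
            (prodBernoulli w).real {ω : BondConfig V | ∀ x ∈ insert z Q, ¬ (openGraph ω).Reachable s x})) :
    (prodBernoulli w).real ({ω : BondConfig V | ∀ x ∈ insert s C, ¬ (openGraph ω).Reachable y x} ∩
        {ω | ∀ x ∈ C, ¬ (openGraph ω).Reachable s x} ∩ openConn y z) *
      ((prodBernoulli w).real {ω : BondConfig V | ∀ x ∈ P ∩ Q, ¬ (openGraph ω).Reachable s x} *
          (prodBernoulli w).real {ω : BondConfig V | ∀ x ∈ insert y (P ∪ Q), ¬ (openGraph ω).Reachable s x} -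
        (prodBernoulli w).real {ω : BondConfig V | ∀ x ∈ P, ¬ (openGraph ω).Reachable s x} *
          (prodBernoulli w).real {ω : BondConfig V | ∀ x ∈ insert y Q, ¬ (openGraph ω).Reachable s x}) ≤
    (prodBernoulli w).real ({ω : BondConfig V | ∀ x ∈ insert s C, ¬ (openGraph ω).Reachable y x} ∩
        {ω | ∀ x ∈ C, ¬ (openGraph ω).Reachable s x}) *
      ((prodBernoulli w).real {ω : BondConfig V | ∀ x ∈ P ∩ Q, ¬ (openGraph ω).Reachable s x} *
          (prodBernoulli w).real {ω : BondConfig V | ∀ x ∈ insert z (P ∪ Q), ¬ (openGraph ω).Reachable s x} -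
        (prodBernoulli w).real {ω : BondConfig V | ∀ x ∈ P, ¬ (openGraph ω).Reachable s x} *
          (prodBernoulli w).real {ω : BondConfig V | ∀ x ∈ insert z Q, ¬ (openGraph ω).Reachable s x}) := by
  classical
  set μ := prodBernoulli w with hμ
  have h0 : ∀ S : Set (BondConfig V), 0 ≤ μ.real S := fun _ => measureReal_nonneg
  set tw := μ.real ({ω : BondConfig V | ∀ x ∈ insert s C, ¬ (openGraph ω).Reachable y x} ∩
    {ω | ∀ x ∈ C, ¬ (openGraph ω).Reachable s x} ∩ openConn y z) with htw
  set t := μ.real ({ω : BondConfig V | ∀ x ∈ insert s C, ¬ (openGraph ω).Reachable y x} ∩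
    {ω | ∀ x ∈ C, ¬ (openGraph ω).Reachable s x}) with ht
  set kI := μ.real {ω : BondConfig V | ∀ x ∈ P ∩ Q, ¬ (openGraph ω).Reachable s x} with hkI
  set kP := μ.real {ω : BondConfig V | ∀ x ∈ P, ¬ (openGraph ω).Reachable s x} with hkP
  set kQ := μ.real {ω : BondConfig V | ∀ x ∈ Q, ¬ (openGraph ω).Reachable s x} with hkQ
  set kU := μ.real {ω : BondConfig V | ∀ x ∈ P ∪ Q, ¬ (openGraph ω).Reachable s x} with hkU
  set kQy := μ.real {ω : BondConfig V | ∀ x ∈ insert y Q, ¬ (openGraph ω).Reachable s x} with hkQy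
  set kQz := μ.real {ω : BondConfig V | ∀ x ∈ insert z Q, ¬ (openGraph ω).Reachable s x} with hkQz
  set kUy := μ.real {ω : BondConfig V | ∀ x ∈ insert y (P ∪ Q), ¬ (openGraph ω).Reachable s x} with hkUy
  set kUz := μ.real {ω : BondConfig V | ∀ x ∈ insert z (P ∪ Q), ¬ (openGraph ω).Reachable s x} with hkUz
  -- van den Berg–Kahn: `K_P K_Q ≤ K_{P∩Q} K_{P∪Q}`
  have hBK : kP * kQ ≤ kI * kU := by
    have hbk := BergKahnAvoidanceLSM_holds V w s P Q
    have e : ∀ X : Set V, {ω : BondConfig V | ∀ x ∈ X, ω ∉ openConn s x} = {ω : BondConfig V | ∀ x ∈ X, ¬ (openGraph ω).Reachable s x} :=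
      fun X => rfl
    rw [e, e, e, e] at hbk
    exact hbk
  -- Z0 for `C ⊆ P ∪ Q`
  have hZ0 := threeSep_notReach_le_of_subset w s y z hCU
  change tw * kUy ≤ t * kUz at hZ0
  change tw * (kQ * kUy - kU * kQy) ≤ t * (kQ * kUz - kU * kQz) at h
  change tw * (kI * kUy - kP * kQy) ≤ t * (kI * kUz - kP * kQz)
  -- `K_U · (goal difference) = K_P · (nested difference) + (K_IK_U − K_PK_Q) · (Z0 difference)`
  have key : kU * (t * (kI * kUz - kP * kQz) - tw * (kI * kUy - kP * kQy)) =
      kP * (t * (kQ * kUz - kU * kQz) - tw * (kQ * kUy - kU * kQy)) + (kI * kU - kP * kQ) * (t * kUz - tw * kUy) := by ring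
  have hsum : 0 ≤ kU * (t * (kI * kUz - kP * kQz) - tw * (kI * kUy - kP * kQy)) := by
    rw [key]
    exact add_nonneg (mul_nonneg (h0 _) (sub_nonneg.2 h)) (mul_nonneg (sub_nonneg.2 hBK) (sub_nonneg.2 hZ0))
  by_cases hU0 : kU = 0
  · -- then `K_P K_Q = 0`; in either case both gaps vanish
    have hUt : ∀ t' : V, μ.real {ω : BondConfig V | ∀ x ∈ insert t' (P ∪ Q), ¬ (openGraph ω).Reachable s x} = 0 := by
      intro t'
      apply le_antisymm _ (h0 _)
      calc μ.real {ω : BondConfig V | ∀ x ∈ insert t' (P ∪ Q), ¬ (openGraph ω).Reachable s x}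
          ≤ kU := measureReal_mono (fun ω hω x hx => hω x (mem_insert_of_mem t' hx))
        _ = 0 := hU0
    have hPQ : kP * kQ = 0 := le_antisymm (by rw [hU0, mul_zero] at hBK; exact hBK) (mul_nonneg (h0 _) (h0 _))
    rcases mul_eq_zero.1 hPQ with hP0 | hQ0
    · rw [hkUy, hkUz] at *
      rw [hUt y, hUt z, hP0]; simp
    · have hQt : ∀ t' : V, μ.real {ω : BondConfig V | ∀ x ∈ insert t' Q, ¬ (openGraph ω).Reachable s x} = 0 := by
        intro t'
        apply le_antisymm _ (h0 _)
        calc μ.real {ω : BondConfig V | ∀ x ∈ insert t' Q, ¬ (openGraph ω).Reachable s x}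
            ≤ kQ := measureReal_mono (fun ω hω x hx => hω x (mem_insert_of_mem t' hx))
          _ = 0 := hQ0
      rw [hkUy, hkUz, hkQy, hkQz] at *
      rw [hUt y, hUt z, hQt y, hQt z]; simp
  · have hUpos : 0 < kU := lt_of_le_of_ne (h0 _) (Ne.symm hU0)
    have : 0 ≤ t * (kI * kUz - kP * kQz) - tw * (kI * kUy - kP * kQy) := by
      by_contra hneg
      push Not at hneg
      have := mul_neg_of_pos_of_neg hUpos hneg
      linarith
    linarith

end Consts

end Summit.CriticalPhenomena.PercolationContinuityZ3.Theorems

end
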